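import Summits.QuantumAdvantage.AdviceFreeQNC0.EliminationHardness
import HarnessLib

/-!
# Cell qa-qnc0 (rung F-Q1, route RingFrame, crux α): elimination against `|u| mod 3` RELATIVE to a
# dense low-degree set

`elimHard_relative` — for every `γ > 0` there are `η, c₀ > 0` such that for `n ≥ n₀`,
`d ≤ c₀√n`, every `v, a, b ∈ lowDeg 𝔽₂ n d` with `#{v ≠ 0} ≥ γ·2ⁿ` and every decoder
`dec : 𝔽₂² → ℕ`: the decoder names the true residue `|u| mod 3` on at least `η·2ⁿ` points OF THE
SUPPORT `{v ≠ 0}`.  Proof: the four level sets `{v ≠ 0, a = α, b = β}` are degree-`3d` supports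
partitioning `{v ≠ 0}`; if the decoder were right on `< η·2ⁿ` support points, each level set
would nearly avoid its named class, hence be `γ/5`-sparse by the landed β-conclusion
`lowDegAvoidMod3Sparse` (Srinivasan's robust Hegedűs lemma), so `#{v ≠ 0} ≤ (4γ/5)·2ⁿ`.
(The tree's `elimSqrtDec_of_lowDegAvoidMod3Sparse` is the case `v = 1`.)

The cell's statement (prover; engine for the interior-cluster special cases of crux α, used by
`JointResidueElimination.lean`); not in print.  WHAT THIS IS NOT: nothing on `LDMAPolylog`,
`TRPlus` or α; no separation.

## References

* S. Srinivasan, *A robust version of Hegedűs's lemma, with applications*, TheoretiCS 2 (2023),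
  Lemma 3.1 [Srinivasan2023].
-/

noncomputable section

namespace Summit.QuantumAdvantage.AdviceFreeQNC0

open Finset
open Literature.Computability.MetaComplexity Literature.Computability.MetaComplexity.Smolensky
open Literature.Computability.MetaComplexity.Hegedus

/-! ### Level sets inside a support -/

/-- Over `𝔽₂`: `x + α + 1 ≠ 0 ↔ x = α`. [folklore] -/
private theorem zmod2_add_add_one_ne_zero_iff' (x α : ZMod 2) : x + α + 1 ≠ 0 ↔ x = α := by
  revert x α; decide

/-- The indicator `v·(a + α + 1)(b + β + 1)` of `{v ≠ 0, a = α, b = β}` has degree `≤ 3d`.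
[folklore] -/
private theorem levelInd3_mem_lowDeg {n d : ℕ} {v a b : CubeFn (ZMod 2) n}
    (hv : v ∈ lowDeg (ZMod 2) n d) (ha : a ∈ lowDeg (ZMod 2) n d) (hb : b ∈ lowDeg (ZMod 2) n d)
    (α β : ZMod 2) :
    v * ((a + (fun _ => α + 1)) * (b + (fun _ => β + 1))) ∈ lowDeg (ZMod 2) n (d + (d + d)) := by
  have hconst : ∀ c : ZMod 2, (fun _ : Fin n → Bool => c) ∈ lowDeg (ZMod 2) n d := by
    intro c
    have h1 : (1 : CubeFn (ZMod 2) n) ∈ lowDeg (ZMod 2) n d := by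
      rw [← mono_empty]; exact mono_mem_lowDeg (by simp)
    have : (fun _ : Fin n → Bool => c) = c • (1 : CubeFn (ZMod 2) n) := by funext u; simp
    rw [this]; exact Submodule.smul_mem _ c h1
  exact mul_mem_lowDeg_add hv (mul_mem_lowDeg_add (Submodule.add_mem _ ha (hconst _))
    (Submodule.add_mem _ hb (hconst _)))

/-- Its support is the level set inside the support of `v`. [folklore] -/
private theorem levelInd3_ne_zero_iff {n : ℕ} (v a b : CubeFn (ZMod 2) n) (α β : ZMod 2)
    (u : Fin n → Bool) :
    (v * ((a + (fun _ => α + 1)) * (b + (fun _ => β + 1))) : CubeFn (ZMod 2) n) u ≠ 0 ↔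
      v u ≠ 0 ∧ a u = α ∧ b u = β := by
  simp only [Pi.mul_apply, Pi.add_apply, mul_ne_zero_iff]
  rw [← add_assoc, ← add_assoc, zmod2_add_add_one_ne_zero_iff', zmod2_add_add_one_ne_zero_iff']

/-- The four level sets partition the support: `Σ_{α,β} #{v ≠ 0, a = α, b = β} = #{v ≠ 0}`.
[folklore] -/
private theorem sum_card_levelSets3 {n : ℕ} (v a b : CubeFn (ZMod 2) n) :
    ∑ p ∈ (univ : Finset (ZMod 2 × ZMod 2)),
      (univ.filter fun u : Fin n → Bool => v u ≠ 0 ∧ a u = p.1 ∧ b u = p.2).card =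
        (univ.filter fun u : Fin n → Bool => v u ≠ 0).card := by
  classical
  have h := card_eq_sum_card_fiberwise (s := univ.filter fun u : Fin n → Bool => v u ≠ 0)
    (t := (univ : Finset (ZMod 2 × ZMod 2))) (f := fun u => (a u, b u)) (fun _ _ => mem_univ _)
  rw [h]
  refine sum_congr rfl fun p _ => ?_
  congr 1
  ext u
  simp [Prod.ext_iff]

/-! ### Elimination relative to a dense low-degree set -/

/-- **Relative elimination hardness.**  For every `γ > 0` there are `η, c₀ > 0` and `n₀` such that
for `n ≥ n₀`, `d ≤ c₀√n`, every `v, a, b ∈ lowDeg 𝔽₂ n d` with `#{v ≠ 0} ≥ γ·2ⁿ` and every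
decoder: `#{u : v u ≠ 0, dec(a u, b u) ≡ |u| (mod 3)} ≥ η·2ⁿ`.  (Cell statement; from
`lowDegAvoidMod3Sparse` on the four degree-`3d` level sets inside `{v ≠ 0}`.)
[cite: Srinivasan2023, Lemma 3.1] -/
theorem elimHard_relative :
    ∀ γ : ℝ, 0 < γ → ∃ η : ℝ, 0 < η ∧ ∃ c₀ : ℝ, 0 < c₀ ∧ ∃ n₀ : ℕ, ∀ n ≥ n₀, ∀ d : ℕ,
      (d : ℝ) ≤ c₀ * Real.sqrt n → ∀ v a b : CubeFn (ZMod 2) n,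
        v ∈ lowDeg (ZMod 2) n d → a ∈ lowDeg (ZMod 2) n d → b ∈ lowDeg (ZMod 2) n d →
          ∀ dec : ZMod 2 → ZMod 2 → ℕ,
            γ * (2 : ℝ) ^ n ≤ ((univ.filter fun u : Fin n → Bool => v u ≠ 0).card : ℝ) →
            η * (2 : ℝ) ^ n ≤ ((univ.filter fun u : Fin n → Bool =>
              v u ≠ 0 ∧ dec (a u) (b u) % 3 = wt u % 3).card : ℝ) := by
  intro γ hγ
  obtain ⟨η, hη, c₁, hc₁, n₀, H⟩ := lowDegAvoidMod3Sparse (γ / 5) (by positivity)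
  refine ⟨η, hη, c₁ / 3, by positivity, n₀, ?_⟩
  intro n hn d hd v a b hv ha hb dec hdense
  classical
  by_contra hlt
  rw [not_le] at hlt
  have hd3 : ((d + (d + d) : ℕ) : ℝ) ≤ c₁ * Real.sqrt n := by push_cast; linarith
  -- every level set inside the support is `γ/5`-sparse
  have key : ∀ α β : ZMod 2,
      ((univ.filter fun u : Fin n → Bool => v u ≠ 0 ∧ a u = α ∧ b u = β).card : ℝ) ≤
        γ / 5 * (2 : ℝ) ^ n := by
    intro α β
    set g : CubeFn (ZMod 2) n := v * ((a + (fun _ => α + 1)) * (b + (fun _ => β + 1))) with hg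
    have hgd : g ∈ lowDeg (ZMod 2) n (d + (d + d)) := levelInd3_mem_lowDeg hv ha hb α β
    have hsupp : (univ.filter fun u : Fin n → Bool => g u ≠ 0) =
        univ.filter fun u : Fin n → Bool => v u ≠ 0 ∧ a u = α ∧ b u = β :=
      filter_congr fun u _ => levelInd3_ne_zero_iff v a b α β u
    have hclass : ((univ.filter fun u : Fin n → Bool => g u ≠ 0 ∧ wt u % 3 = dec α β % 3).card : ℝ)
        ≤ η * (2 : ℝ) ^ n := by
      have hsub : (univ.filter fun u : Fin n → Bool => g u ≠ 0 ∧ wt u % 3 = dec α β % 3) ⊆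
          univ.filter fun u : Fin n → Bool => v u ≠ 0 ∧ dec (a u) (b u) % 3 = wt u % 3 := by
        intro u hu
        rw [mem_filter] at hu ⊢
        obtain ⟨hvu, hau, hbu⟩ := (levelInd3_ne_zero_iff v a b α β u).1 hu.2.1
        refine ⟨hu.1, hvu, ?_⟩
        rw [hau, hbu]
        exact hu.2.2.symm
      have h1 : ((univ.filter fun u : Fin n → Bool => g u ≠ 0 ∧ wt u % 3 = dec α β % 3).card : ℝ) ≤
          ((univ.filter fun u : Fin n → Bool =>
            v u ≠ 0 ∧ dec (a u) (b u) % 3 = wt u % 3).card : ℝ) := by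
        exact_mod_cast card_le_card hsub
      linarith
    have hres := H n hn (dec α β) (d + (d + d)) hd3 g hgd hclass
    rwa [hsupp] at hres
  -- but they cover the support
  have hsumR : ∑ p ∈ (univ : Finset (ZMod 2 × ZMod 2)),
      ((univ.filter fun u : Fin n → Bool => v u ≠ 0 ∧ a u = p.1 ∧ b u = p.2).card : ℝ) =
        ((univ.filter fun u : Fin n → Bool => v u ≠ 0).card : ℝ) := by
    exact_mod_cast sum_card_levelSets3 v a b
  have hle : ∑ p ∈ (univ : Finset (ZMod 2 × ZMod 2)),
      ((univ.filter fun u : Fin n → Bool => v u ≠ 0 ∧ a u = p.1 ∧ b u = p.2).card : ℝ) ≤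
        ∑ _p ∈ (univ : Finset (ZMod 2 × ZMod 2)), γ / 5 * (2 : ℝ) ^ n :=
    sum_le_sum fun p _ => key p.1 p.2
  rw [sum_const, card_univ] at hle
  have hcard : Fintype.card (ZMod 2 × ZMod 2) = 4 := by simp
  rw [hcard, hsumR, nsmul_eq_mul] at hle
  push_cast at hle
  have hpos : (0 : ℝ) < γ * (2 : ℝ) ^ n := by positivity
  linarith

end Summit.QuantumAdvantage.AdviceFreeQNC0
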